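import Summits.BirchSwinnertonDyer.BirchSwinnertonDyer.Theorems.ManinLocalTwoThreeCuspHeckeShift
import HarnessLib

/-!
# `ρ_r` and `ρ_r⁻¹` on `Γ₀(M)`-orbits of cusps: an action of `(ℤ/M)^×`

Summit `BirchSwinnertonDyer`, route `ManinLocalTwoThree` (cell bsd-f2-manin), cruxes C2 `ManinOddAtFour`
(stmt-BirchSwinnertonDyer-22967) / C3 `ManinPrimeToThreeAtNine` (stmt-BirchSwinnertonDyer-22968).  Fifth file of the
cusp-symbol layer (MEMO-es §22–§23) toward E-es-30 `BoundaryEisenstein`.  The two neighbour maps `ρ_r = heckeNbrInfty hr`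
and `ρ_r⁻¹ = heckeNbrZero hr` of `Theorems/ManinLocalTwoThreeDefs.lean` (classes `(c, r d)` and `(r c, d)` of the bottom
row `(c, d)`, previous file) pass to the finite set `Γ₀(M)\P¹(ℚ)` of cusp classes for every prime `r ∤ M`, and there:

* they preserve `Γ₀(M)`-orbits (`sameOrbit_heckeNbrInfty`, `sameOrbit_heckeNbrZero`);
* they are mutually inverse (`sameOrbit_heckeNbrZero_heckeNbrInfty`, `sameOrbit_heckeNbrInfty_heckeNbrZero`);
* `ρ_q ρ_r = ρ_r ρ_q` (`sameOrbit_heckeNbrInfty_comm`);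
* `ρ_{r₁} ρ_{r₂} = ρ_u` whenever `r₁ r₂ ≡ u (mod M)` (`sameOrbit_heckeNbrInfty_heckeNbrInfty_of_dvd`), `ρ_u = 1` whenever
  `u ≡ 1 (mod M)` (`sameOrbit_heckeNbrInfty_self_of_dvd`), `ρ_r = ρ_{r'}` whenever `r ≡ r' (mod M)`
  (`sameOrbit_heckeNbrInfty_of_dvd`)

— i.e. `r ↦ ρ_r` is the action `[(c : d)] ↦ [(c : a d)]` of `a = r mod M ∈ (ℤ/M)^×` (MEMO-es §22.3: «`σ_r` = multiplication
by `r` on `(ℤ/g_d)^×/±1`»), stated orbitwise («`∃ γ ∈ Γ₀(M), γ · lhs = rhs`») so that every `Γ₀(M)`-invariant function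
takes equal values on the two sides.  All proofs are chains in the bottom-row relation `∃ k, M ∣ c'(d + kc) − d'c` of
`Theorems/ManinLocalTwoThreeCuspClasses.lean` through primitive middle pairs (`sameOrbit_of_classes`).

No new definitions; nothing about BSD or Manin's conjecture is proved here.

References: F. Diamond, J. Shurman, GTM 228, Prop. 3.8.3 and §5.2; G. Shimura (1971) §8.3; cell memo HOME/MEMO-es.md §22.3.
-/

set_option autoImplicit false
set_option linter.dupNamespace false

open scoped MatrixGroups

open CongruenceSubgroup Matrix.SpecialLinearGroup Literature.NumberTheory.EllipticCurves.ModularForms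

namespace Summit.BirchSwinnertonDyer.BirchSwinnertonDyer.Theorems.ManinLocalTwoThree

/-! ### Chains of classes (plumbing) -/

section Chains

variable (M : ℕ)

/-- **Two cusps are in one `Γ₀(M)`-orbit when their matrices' bottom rows are related to related primitive pairs**:
if `bottom P₁ ~ v`, `bottom P₂ ~ v'` (stated as `v ~ bottom Pᵢ`), `v ~ v'`, and `v, v'` are primitive mod `M`, then
`γ P₁ ∞ = P₂ ∞` for some `γ ∈ Γ₀(M)`. [folklore] -/
theorem sameOrbit_of_classes {P₁ P₂ : SL(2, ℤ)} {c₁ d₁ c₂ d₂ : ℤ}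
    (hv : ∃ α β μ : ℤ, α * c₁ + β * d₁ + μ * M = 1) (hv' : ∃ α β μ : ℤ, α * c₂ + β * d₂ + μ * M = 1)
    (h₁ : ∃ k : ℤ, (M : ℤ) ∣ P₁ 1 0 * (d₁ + k * c₁) - P₁ 1 1 * c₁)
    (h₂ : ∃ k : ℤ, (M : ℤ) ∣ P₂ 1 0 * (d₂ + k * c₂) - P₂ 1 1 * c₂)
    (hvv' : ∃ k : ℤ, (M : ℤ) ∣ c₂ * (d₁ + k * c₁) - d₂ * c₁) :
    ∃ γ : Gamma0 M, (mapGL ℚ (γ : SL(2, ℤ)) : GL (Fin 2) ℚ) • (mapGL ℚ P₁ : GL (Fin 2) ℚ) • (OnePoint.infty : OnePoint ℚ)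
      = (mapGL ℚ P₂ : GL (Fin 2) ℚ) • OnePoint.infty := by
  apply exists_gamma0_smul_eq_of_cuspRel M P₁ P₂
  have a1 : ∃ k : ℤ, (M : ℤ) ∣ c₂ * (P₁ 1 1 + k * P₁ 1 0) - d₂ * P₁ 1 0 :=
    cuspRel_trans (M : ℤ) hv (cuspRel_symm (M : ℤ) h₁) hvv'
  exact cuspRel_trans (M : ℤ) hv' a1 h₂

/-- Units mod `M` multiply (plumbing). [folklore] -/
theorem unit_mul {M a b s₁ t₁ s₂ t₂ : ℤ} (h₁ : s₁ * a + t₁ * M = 1) (h₂ : s₂ * b + t₂ * M = 1) :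
    ∃ s t : ℤ, s * (a * b) + t * M = 1 :=
  ⟨s₁ * s₂, s₁ * a * t₂ + t₁ * s₂ * b + t₁ * t₂ * M, by linear_combination (s₂ * b + t₂ * M) * h₁ + h₂⟩

/-- `(c, a d) ~ (c, a' d)` whenever `M ∣ a − a'` (take `k = 0`). [folklore] -/
theorem cuspRel_congr {a a' : ℤ} (h : (M : ℤ) ∣ a - a') (c d : ℤ) :
    ∃ k : ℤ, (M : ℤ) ∣ c * (a * d + k * c) - (a' * d) * c := by
  obtain ⟨m, hm⟩ := h
  exact ⟨0, c * d * m, by linear_combination c * d * hm⟩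

end Chains

/-! ### `ρ_r`, `ρ_r⁻¹` preserve orbits -/

section Orbits

variable {r : ℕ} [NeZero r] (hr : r.Prime) (M : ℕ)

/-- **`ρ_r` is well defined on `Γ₀(M)`-orbits** (`r ∤ M`). [cite: DiamondShurman2005, Prop. 3.8.3] -/
theorem sameOrbit_heckeNbrInfty (hM : ¬ r ∣ M) {x y : OnePoint ℚ}
    (hxy : ∃ γ : Gamma0 M, (mapGL ℚ (γ : SL(2, ℤ)) : GL (Fin 2) ℚ) • x = y) :
    ∃ γ : Gamma0 M, (mapGL ℚ (γ : SL(2, ℤ)) : GL (Fin 2) ℚ) • heckeNbrInfty hr x = heckeNbrInfty hr y := by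
  obtain ⟨s, t, hst⟩ := exists_unit_of_prime_not_dvd hr hM
  obtain ⟨γ, hγ⟩ := hxy
  obtain ⟨P₁, hP₁, h₁⟩ := heckeNbrInfty_class hr M hM (cuspMatrix x) x (cuspMatrix_smul_infty x)
  obtain ⟨P₂, hP₂, h₂⟩ := heckeNbrInfty_class hr M hM (cuspMatrix y) y (cuspMatrix_smul_infty y)
  have hg : ∃ k : ℤ, (M : ℤ) ∣ (cuspMatrix y) 1 0 * ((cuspMatrix x) 1 1 + k * (cuspMatrix x) 1 0)
      - (cuspMatrix y) 1 1 * (cuspMatrix x) 1 0 :=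
    cuspRel_of_gamma0_smul_eq M (cuspMatrix x) (cuspMatrix y) γ (by rw [cuspMatrix_smul_infty, hγ, cuspMatrix_smul_infty])
  rw [hP₁, hP₂]
  exact sameOrbit_of_classes M (primitive_mul_right (M : ℤ) (det_entries (cuspMatrix x)) hst)
    (primitive_mul_right (M : ℤ) (det_entries (cuspMatrix y)) hst) h₁ h₂ (cuspRel_mul_right (M : ℤ) (r : ℤ) hg)

/-- **`ρ_r⁻¹` is well defined on `Γ₀(M)`-orbits** (`r ∤ M`). [cite: DiamondShurman2005, Prop. 3.8.3] -/
theorem sameOrbit_heckeNbrZero (hM : ¬ r ∣ M) {x y : OnePoint ℚ}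
    (hxy : ∃ γ : Gamma0 M, (mapGL ℚ (γ : SL(2, ℤ)) : GL (Fin 2) ℚ) • x = y) :
    ∃ γ : Gamma0 M, (mapGL ℚ (γ : SL(2, ℤ)) : GL (Fin 2) ℚ) • heckeNbrZero hr x = heckeNbrZero hr y := by
  obtain ⟨s, t, hst⟩ := exists_unit_of_prime_not_dvd hr hM
  obtain ⟨γ, hγ⟩ := hxy
  obtain ⟨Q₁, hQ₁, h₁⟩ := heckeNbrZero_class hr M hM (cuspMatrix x) x (cuspMatrix_smul_infty x)
  obtain ⟨Q₂, hQ₂, h₂⟩ := heckeNbrZero_class hr M hM (cuspMatrix y) y (cuspMatrix_smul_infty y)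
  have hg : ∃ k : ℤ, (M : ℤ) ∣ (cuspMatrix y) 1 0 * ((cuspMatrix x) 1 1 + k * (cuspMatrix x) 1 0)
      - (cuspMatrix y) 1 1 * (cuspMatrix x) 1 0 :=
    cuspRel_of_gamma0_smul_eq M (cuspMatrix x) (cuspMatrix y) γ (by rw [cuspMatrix_smul_infty, hγ, cuspMatrix_smul_infty])
  rw [hQ₁, hQ₂]
  exact sameOrbit_of_classes M (primitive_mul_left (M : ℤ) (det_entries (cuspMatrix x)) hst)
    (primitive_mul_left (M : ℤ) (det_entries (cuspMatrix y)) hst) h₁ h₂ (cuspRel_mul_left (M : ℤ) hst hg)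

/-! ### `ρ_r⁻¹ ρ_r = 1 = ρ_r ρ_r⁻¹` on orbits -/

/-- **`ρ_r⁻¹ (ρ_r x) ∈ Γ₀(M) x`** (`r ∤ M`): classes `(c,d) ↦ (c, r d) ↦ (r c, r d) = (c, d)`. [cite: DiamondShurman2005, Prop. 3.8.3] -/
theorem sameOrbit_heckeNbrZero_heckeNbrInfty (hM : ¬ r ∣ M) (x : OnePoint ℚ) :
    ∃ γ : Gamma0 M, (mapGL ℚ (γ : SL(2, ℤ)) : GL (Fin 2) ℚ) • heckeNbrZero hr (heckeNbrInfty hr x) = x := by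
  obtain ⟨s, t, hst⟩ := exists_unit_of_prime_not_dvd hr hM
  set g : SL(2, ℤ) := cuspMatrix x with hg
  obtain ⟨P, hP, h₁⟩ := heckeNbrInfty_class hr M hM g x (cuspMatrix_smul_infty x)
  obtain ⟨Q, hQ, h₂⟩ := heckeNbrZero_class hr M hM P (heckeNbrInfty hr x) hP.symm
  rw [hQ]
  conv_rhs => rw [← cuspMatrix_smul_infty x]
  -- chain: bottom Q ~ (r P₁₀, P₁₁) ~ (r c, r d) ~ (c, d) = bottom g
  refine sameOrbit_of_classes M (primitive_mul_left (M : ℤ) (det_entries P) hst)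
    (primitive_scale (det_entries g) hst) h₂ ?_ ?_
  · exact cuspRel_symm (M : ℤ) (cuspRel_scale (M : ℤ) (g 1 0) (g 1 1) (r : ℤ))
  · exact cuspRel_symm (M : ℤ) (cuspRel_mul_left (M : ℤ) hst h₁)

/-- **`ρ_r (ρ_r⁻¹ x) ∈ Γ₀(M) x`** (`r ∤ M`): classes `(c,d) ↦ (r c, d) ↦ (r c, r d) = (c, d)`. [cite: DiamondShurman2005, Prop. 3.8.3] -/
theorem sameOrbit_heckeNbrInfty_heckeNbrZero (hM : ¬ r ∣ M) (x : OnePoint ℚ) :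
    ∃ γ : Gamma0 M, (mapGL ℚ (γ : SL(2, ℤ)) : GL (Fin 2) ℚ) • heckeNbrInfty hr (heckeNbrZero hr x) = x := by
  obtain ⟨s, t, hst⟩ := exists_unit_of_prime_not_dvd hr hM
  set g : SL(2, ℤ) := cuspMatrix x with hg
  obtain ⟨Q, hQ, h₁⟩ := heckeNbrZero_class hr M hM g x (cuspMatrix_smul_infty x)
  obtain ⟨P, hP, h₂⟩ := heckeNbrInfty_class hr M hM Q (heckeNbrZero hr x) hQ.symm
  rw [hP]
  conv_rhs => rw [← cuspMatrix_smul_infty x]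
  -- chain: bottom P ~ (Q₁₀, r Q₁₁) ~ (r c, r d) ~ (c, d)
  refine sameOrbit_of_classes M (primitive_mul_right (M : ℤ) (det_entries Q) hst)
    (primitive_scale (det_entries g) hst) h₂ ?_ ?_
  · exact cuspRel_symm (M : ℤ) (cuspRel_scale (M : ℤ) (g 1 0) (g 1 1) (r : ℤ))
  · exact cuspRel_symm (M : ℤ) (cuspRel_mul_right (M : ℤ) (r : ℤ) h₁)

end Orbits

/-! ### `ρ` depends on `r mod M` only and is multiplicative -/

section Action

variable (M : ℕ)

/-- **`ρ_{r₁} (ρ_{r₂} x) ∈ Γ₀(M) ρ_u x` whenever `r₁ r₂ ≡ u (mod M)`** (primes not dividing `M`): classes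
`(c, r₁ r₂ d) ~ (c, u d)`. [cite: DiamondShurman2005, Prop. 3.8.3] -/
theorem sameOrbit_heckeNbrInfty_heckeNbrInfty_of_dvd {r₁ r₂ u : ℕ} [NeZero r₁] [NeZero r₂] [NeZero u]
    (h₁ : r₁.Prime) (h₂ : r₂.Prime) (hu : u.Prime) (hM₁ : ¬ r₁ ∣ M) (hM₂ : ¬ r₂ ∣ M) (hMu : ¬ u ∣ M)
    (hcong : (M : ℤ) ∣ (r₁ : ℤ) * r₂ - u) (x : OnePoint ℚ) :
    ∃ γ : Gamma0 M, (mapGL ℚ (γ : SL(2, ℤ)) : GL (Fin 2) ℚ) • heckeNbrInfty h₁ (heckeNbrInfty h₂ x)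
      = heckeNbrInfty hu x := by
  obtain ⟨s₁, t₁, hst₁⟩ := exists_unit_of_prime_not_dvd h₁ hM₁
  obtain ⟨s₂, t₂, hst₂⟩ := exists_unit_of_prime_not_dvd h₂ hM₂
  obtain ⟨su, tu, hstu⟩ := exists_unit_of_prime_not_dvd hu hMu
  obtain ⟨s, t, hst⟩ := unit_mul hst₁ hst₂
  set g : SL(2, ℤ) := cuspMatrix x with hg
  obtain ⟨P₂, hP₂, c₂⟩ := heckeNbrInfty_class h₂ M hM₂ g x (cuspMatrix_smul_infty x)
  obtain ⟨P₁₂, hP₁₂, c₁₂⟩ := heckeNbrInfty_class h₁ M hM₁ P₂ (heckeNbrInfty h₂ x) hP₂.symm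
  obtain ⟨Pu, hPu, cu⟩ := heckeNbrInfty_class hu M hMu g x (cuspMatrix_smul_infty x)
  rw [hP₁₂, hPu]
  -- `(c, r₁ r₂ d) ~ (P₂₁₀, r₁ P₂₁₁) ~ bottom P₁₂`
  have a : ∃ k : ℤ, (M : ℤ) ∣ P₁₂ 1 0 * ((r₁ : ℤ) * r₂ * g 1 1 + k * g 1 0) - P₁₂ 1 1 * g 1 0 := by
    have b := cuspRel_trans (M : ℤ) (primitive_mul_right (M : ℤ) (det_entries P₂) hst₁)
      (cuspRel_mul_right (M : ℤ) (r₁ : ℤ) c₂) c₁₂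
    obtain ⟨k, hk⟩ := b
    exact ⟨k, by rw [show (r₁ : ℤ) * r₂ * g 1 1 = r₁ * (r₂ * g 1 1) by ring]; exact hk⟩
  exact sameOrbit_of_classes M (primitive_mul_right (M : ℤ) (det_entries g) hst)
    (primitive_mul_right (M : ℤ) (det_entries g) hstu) a cu (cuspRel_congr M hcong (g 1 0) (g 1 1))

/-- **`ρ_u x ∈ Γ₀(M) x` whenever `u ≡ 1 (mod M)`**: classes `(c, u d) ~ (c, d)`. [cite: DiamondShurman2005, Prop. 3.8.3] -/
theorem sameOrbit_heckeNbrInfty_self_of_dvd {u : ℕ} [NeZero u] (hu : u.Prime) (hMu : ¬ u ∣ M)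
    (hcong : (M : ℤ) ∣ (u : ℤ) - 1) (x : OnePoint ℚ) :
    ∃ γ : Gamma0 M, (mapGL ℚ (γ : SL(2, ℤ)) : GL (Fin 2) ℚ) • heckeNbrInfty hu x = x := by
  obtain ⟨su, tu, hstu⟩ := exists_unit_of_prime_not_dvd hu hMu
  set g : SL(2, ℤ) := cuspMatrix x with hg
  obtain ⟨Pu, hPu, cu⟩ := heckeNbrInfty_class hu M hMu g x (cuspMatrix_smul_infty x)
  rw [hPu]
  conv_rhs => rw [← cuspMatrix_smul_infty x]
  refine sameOrbit_of_classes M (primitive_mul_right (M : ℤ) (det_entries g) hstu)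
    (sl_bottom_primitive (M : ℤ) g) cu (cuspRel_refl (M : ℤ) (g 1 0) (g 1 1)) ?_
  have h := cuspRel_congr M hcong (g 1 0) (g 1 1)
  simp only [one_mul] at h
  exact h

/-- **`ρ_r x ∈ Γ₀(M) ρ_{r'} x` whenever `r ≡ r' (mod M)`**: classes `(c, r d) ~ (c, r' d)`. [cite: DiamondShurman2005, Prop. 3.8.3] -/
theorem sameOrbit_heckeNbrInfty_of_dvd {r r' : ℕ} [NeZero r] [NeZero r'] (hr : r.Prime) (hr' : r'.Prime)
    (hM : ¬ r ∣ M) (hM' : ¬ r' ∣ M) (hcong : (M : ℤ) ∣ (r : ℤ) - r') (x : OnePoint ℚ) :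
    ∃ γ : Gamma0 M, (mapGL ℚ (γ : SL(2, ℤ)) : GL (Fin 2) ℚ) • heckeNbrInfty hr x = heckeNbrInfty hr' x := by
  obtain ⟨s, t, hst⟩ := exists_unit_of_prime_not_dvd hr hM
  obtain ⟨s', t', hst'⟩ := exists_unit_of_prime_not_dvd hr' hM'
  set g : SL(2, ℤ) := cuspMatrix x with hg
  obtain ⟨P, hP, c⟩ := heckeNbrInfty_class hr M hM g x (cuspMatrix_smul_infty x)
  obtain ⟨P', hP', c'⟩ := heckeNbrInfty_class hr' M hM' g x (cuspMatrix_smul_infty x)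
  rw [hP, hP']
  exact sameOrbit_of_classes M (primitive_mul_right (M : ℤ) (det_entries g) hst)
    (primitive_mul_right (M : ℤ) (det_entries g) hst') c c' (cuspRel_congr M hcong (g 1 0) (g 1 1))

/-- **`ρ_q ρ_r = ρ_r ρ_q` on orbits** (primes `q, r ∤ M`): both sides have class `(c, q r d)`. [cite: DiamondShurman2005, Prop. 3.8.3] -/
theorem sameOrbit_heckeNbrInfty_comm {q r : ℕ} [NeZero q] [NeZero r] (hq : q.Prime) (hr : r.Prime)
    (hMq : ¬ q ∣ M) (hMr : ¬ r ∣ M) (x : OnePoint ℚ) :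
    ∃ γ : Gamma0 M, (mapGL ℚ (γ : SL(2, ℤ)) : GL (Fin 2) ℚ) • heckeNbrInfty hq (heckeNbrInfty hr x)
      = heckeNbrInfty hr (heckeNbrInfty hq x) := by
  obtain ⟨sq, tq, hstq⟩ := exists_unit_of_prime_not_dvd hq hMq
  obtain ⟨sr, tr, hstr⟩ := exists_unit_of_prime_not_dvd hr hMr
  obtain ⟨s, t, hst⟩ := unit_mul hstq hstr
  set g : SL(2, ℤ) := cuspMatrix x with hg
  obtain ⟨Pr, hPr, cr⟩ := heckeNbrInfty_class hr M hMr g x (cuspMatrix_smul_infty x)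
  obtain ⟨Pqr, hPqr, cqr⟩ := heckeNbrInfty_class hq M hMq Pr (heckeNbrInfty hr x) hPr.symm
  obtain ⟨Pq, hPq, cq⟩ := heckeNbrInfty_class hq M hMq g x (cuspMatrix_smul_infty x)
  obtain ⟨Prq, hPrq, crq⟩ := heckeNbrInfty_class hr M hMr Pq (heckeNbrInfty hq x) hPq.symm
  rw [hPqr, hPrq]
  have a : ∃ k : ℤ, (M : ℤ) ∣ Pqr 1 0 * ((q : ℤ) * r * g 1 1 + k * g 1 0) - Pqr 1 1 * g 1 0 := by
    obtain ⟨k, hk⟩ := cuspRel_trans (M : ℤ) (primitive_mul_right (M : ℤ) (det_entries Pr) hstq)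
      (cuspRel_mul_right (M : ℤ) (q : ℤ) cr) cqr
    exact ⟨k, by rw [show (q : ℤ) * r * g 1 1 = q * (r * g 1 1) by ring]; exact hk⟩
  have b : ∃ k : ℤ, (M : ℤ) ∣ Prq 1 0 * ((q : ℤ) * r * g 1 1 + k * g 1 0) - Prq 1 1 * g 1 0 := by
    obtain ⟨k, hk⟩ := cuspRel_trans (M : ℤ) (primitive_mul_right (M : ℤ) (det_entries Pq) hstr)
      (cuspRel_mul_right (M : ℤ) (r : ℤ) cq) crq
    exact ⟨k, by rw [show (q : ℤ) * r * g 1 1 = r * (q * g 1 1) by ring]; exact hk⟩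
  exact sameOrbit_of_classes M (primitive_mul_right (M : ℤ) (det_entries g) hst)
    (primitive_mul_right (M : ℤ) (det_entries g) hst) a b (cuspRel_refl (M : ℤ) (g 1 0) ((q : ℤ) * r * g 1 1))

end Action

end Summit.BirchSwinnertonDyer.BirchSwinnertonDyer.Theorems.ManinLocalTwoThree
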